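import Summits.RiemannHypothesis.RiemannHypothesis.Theorems.PfPersistenceF3TameDatum
import HarnessLib

/-!
# F3 — THEOREM F3-B: the HOST-GENERIC deletion dichotomy over `ExplicitDatum` (PROVED) — pub-rhpf fake-3, gen 5

HONEST FRAMING: mechanism/rigidity campaign; no RH claims.  Every positivity statement about a host
enters as a HYPOTHESIS (`E.PositivityOn (c + b)`); nothing here asserts that any L-function is
Weil-positive.

THEOREM F3-B (`HOME/FAKES.md` §3 ADDENDUM (gen 2), item 3; typed as
`HOME/lean/PFPersistence/F3DeletionTwinsTarget.lean`; labelled THEOREM-informal by RULING A265 (3)) is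
the host-generic form of fake-5's THEOREM F5-A (`PfPersistenceF5TailTwins.tailDialRayleighBound`, the
case `E = zetaDatum`, one prime deleted or dialled): let `E` be an explicit datum, `S` a set of indices
whose masses visible in the doubled window `[-2(c+b), 2(c+b)]` all sit at `± 2c` with real non-negative
weights of total `w = deletedWeightAt E S c`; if `E` is window-positive up to `c + b` and `g₁` is a Weil
test supported in `[-b, b]` (`0 < b < c`) with `Re Q_E(g₁) ≤ ε ‖g₁‖₂²`, then the odd twin
`g = τ_{-c} g₁ - τ_{c} g₁` satisfies

  `Re Q_{E ∖ S}(g) ≤ (2ε - w) · 2‖g₁‖₂²`                      (`deletionTwinRayleighBound`),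

so `E ∖ S` is Weil-NEGATIVE at window `c + b` as soon as `2ε < w` — OR the host is not positive there
(`deletion_negative_or_host_not_positive`, `host_not_positivityOn_or_deletion_not_positivityOn`).
It is PROVED here for every TAME host (`ExplicitDatum.IsTame`, file `PfPersistenceF3TameDatum`: smooth
part additive on test kernels, positions locally finite — `ζ`, the `S♯` twins and all their deletions
are tame) by F5-A's argument made abstract: translation invariance of `Q_E`; the parallelogram law
`A_{u+v} + A_{u-v} = 2A_u + 2A_v` plus additivity of `W_E` and positivity at `u + v` give
`Re Q_E(u - v) ≤ 4ε‖g₁‖₂²`; deleting the masses at `± 2c` changes `W` at `A_g` by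
`w · (A_g(2c) + A_g(-2c)) = -2w‖g₁‖₂²` (fake-5's `weilConv_weilReflect_twin_(neg_)two_mul`).
Sanity instance: `E = zetaDatum`, `S = {p}` recovers F5-A at `K = 0` with the same constant
`2ε - log p/√p` (`zeta_primeDeletion_rayleighBound`).  Consumers: fake-5 / fake-4 (tail and prime
deletions of `ζ`), fake-3's degree-2 deletion twins `Z_D` of `ζ_K` (FAKES §3.7, GAP row G-F3-3: that
instance needs a `ζ_K` datum, not in the tree — the theorem is stated for every tame host so that it
applies verbatim once one is declared and shown tame).
-/

set_option linter.dupNamespace false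

noncomputable section

open MeasureTheory Set Filter Complex
open scoped Real Topology ComplexConjugate

namespace Summit.RiemannHypothesis.RiemannHypothesis.Theorems.PfPersistenceBarrier

open Literature.NumberTheory.LFunctions
open Summit.RiemannHypothesis.RiemannHypothesis.Theorems.PfPersistenceF5TailTwins
  (twin twin_eq_add isWeilTest_twin tsupport_twin_subset tsupport_add_mul_subset
   weilConv_weilReflect_translate weilConv_weilReflect_twin_two_mul weilConv_weilReflect_twin_neg_two_mul)
-- `translate`, `isWeilTest_translate`, `tsupport_translate_subset` are written with the prefix
-- `PfPersistenceF5TailTwins.` below (Mathlib's `_root_.translate` and the Literature lemmas of the same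
-- names for `t ↦ g (t + c)` would otherwise be ambiguous).

namespace ExplicitDatum

variable {E : ExplicitDatum} {S : Set ℕ}

/-! ## THEOREM F3-B -/

open Classical in
/-- The total (real part of the) weight deleted at the positions `± 2c`. [folklore] -/
def deletedWeightAt (E : ExplicitDatum) (S : Set ℕ) (c : ℝ) : ℝ :=
  ∑' i : ℕ, if i ∈ S ∧ |E.pos i| = 2 * c then (E.wt i).re else 0

open Classical in
/-- The deleted weight as a finite sum. [folklore] -/
theorem deletedWeightAt_eq_sum (E : ExplicitDatum) (S : Set ℕ) {c R : ℝ} (hR : 2 * c ≤ R)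
    {T : Finset ℕ} (hT : ∀ i, |E.pos i| ≤ R → i ∈ T) :
    E.deletedWeightAt S c = ∑ i ∈ T, if i ∈ S ∧ |E.pos i| = 2 * c then (E.wt i).re else 0 := by
  unfold deletedWeightAt
  refine tsum_eq_sum fun i hi ↦ ?_
  rw [if_neg]
  rintro ⟨_, h⟩
  exact hi (hT i (by rw [h]; exact hR))

/-- **THEOREM F3-B, quantitative form** (a `Prop`; proved below for every tame host as
`deletionTwinRayleighBound`): the statement of `HOME/lean/PFPersistence/F3DeletionTwinsTarget.lean`
verbatim, over the tree's `ExplicitDatum.deleteMasses`. (A `Prop`, statement only; proved below for every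
tame host.) -/
def DeletionTwinRayleighBound (E : ExplicitDatum) (S : Set ℕ) (c : ℝ) : Prop :=
  ∀ (b ε : ℝ), 0 < b → b < c →
    (∀ i ∈ S, |E.pos i| = 2 * c ∨ 2 * (c + b) < |E.pos i|) →
    (∀ i ∈ S, |E.pos i| = 2 * c → (E.wt i).im = 0 ∧ 0 ≤ (E.wt i).re) →
    E.PositivityOn (c + b) →
    ∀ g₁ : ℝ → ℂ, IsWeilTest g₁ → tsupport g₁ ⊆ Icc (-b) b →
      (E.quadratic g₁).re ≤ ε * ∫ x, ‖g₁ x‖ ^ 2 →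
        ((E.deleteMasses S).quadratic (twin c 1 g₁)).re ≤
          (2 * ε - E.deletedWeightAt S c) * (2 * ∫ x, ‖g₁ x‖ ^ 2)

open Classical in
/-- **THEOREM F3-B (quantitative form), PROVED for every tame host.** [folklore] -/
theorem deletionTwinRayleighBound (hE : E.IsTame) (S : Set ℕ) (c : ℝ) :
    E.DeletionTwinRayleighBound S c := by
  intro b ε hb hbc hpos _hwt hW g₁ hg hs hq
  obtain ⟨N, hN_def⟩ : ∃ N : ℝ, N = ∫ x, ‖g₁ x‖ ^ 2 := ⟨_, rfl⟩
  rw [← hN_def] at hq ⊢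
  have hc0 : 0 < c := lt_trans hb hbc
  -- fake-5's twin identities, instantiated before abbreviating
  have htwin := twin_eq_add c 1 g₁
  have hA1 := weilConv_weilReflect_twin_two_mul hs hb hbc 1
  have hA2 := weilConv_weilReflect_twin_neg_two_mul hs hb hbc 1
  rw [← hN_def] at hA1 hA2
  rw [htwin] at hA1 hA2 ⊢
  -- the two translates
  set u : ℝ → ℂ := PfPersistenceF5TailTwins.translate (-c) g₁ with hu_def
  set v : ℝ → ℂ := PfPersistenceF5TailTwins.translate c g₁ with hv_def
  have hu : IsWeilTest u := PfPersistenceF5TailTwins.isWeilTest_translate hg _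
  have hv : IsWeilTest v := PfPersistenceF5TailTwins.isWeilTest_translate hg _
  have hus : tsupport u ⊆ Icc (-(c + b)) (c + b) :=
    (PfPersistenceF5TailTwins.tsupport_translate_subset hs (-c)).trans
      (Icc_subset_Icc (by linarith) (by linarith))
  have hvs : tsupport v ⊆ Icc (-(c + b)) (c + b) :=
    (PfPersistenceF5TailTwins.tsupport_translate_subset hs c).trans
      (Icc_subset_Icc (by linarith) (by linarith))
  have hQu : (E.quadratic u).re = (E.quadratic g₁).re := by rw [hu_def, quadratic_translate]
  have hQv : (E.quadratic v).re = (E.quadratic g₁).re := by rw [hv_def, quadratic_translate]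
  -- the parallelogram law, instantiated before abbreviating the twins
  have hparA := autocorr_parallelogram hu hv
  set gm : ℝ → ℂ := u + fun x ↦ ((-1 : ℝ) : ℂ) * v x with hgm_def
  set gp : ℝ → ℂ := u + fun x ↦ ((1 : ℝ) : ℂ) * v x with hgp_def
  have hgm : IsWeilTest gm := hu.add (hv.const_mul _)
  have hgp : IsWeilTest gp := hu.add (hv.const_mul _)
  have hgps : tsupport gp ⊆ Icc (-(c + b)) (c + b) := tsupport_add_mul_subset isClosed_Icc hus hvs _
  have hgms : tsupport gm ⊆ Icc (-(c + b)) (c + b) := tsupport_add_mul_subset isClosed_Icc hus hvs _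
  -- autocorrelations: Weil tests supported in the doubled window
  have hAu : IsWeilTest (weilConv u (weilReflect u)) := hu.weilConv hu.weilReflect
  have hAv : IsWeilTest (weilConv v (weilReflect v)) := hv.weilConv hv.weilReflect
  have hAm : IsWeilTest (weilConv gm (weilReflect gm)) := hgm.weilConv hgm.weilReflect
  have hAp : IsWeilTest (weilConv gp (weilReflect gp)) := hgp.weilConv hgp.weilReflect
  have hAus : tsupport (weilConv u (weilReflect u)) ⊆ Icc (-(2 * (c + b))) (2 * (c + b)) :=
    tsupport_weilConv_weilReflect_subset hu.2 hus
  have hAvs : tsupport (weilConv v (weilReflect v)) ⊆ Icc (-(2 * (c + b))) (2 * (c + b)) :=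
    tsupport_weilConv_weilReflect_subset hv.2 hvs
  have hAms : tsupport (weilConv gm (weilReflect gm)) ⊆ Icc (-(2 * (c + b))) (2 * (c + b)) :=
    tsupport_weilConv_weilReflect_subset hgm.2 hgms
  have hAps : tsupport (weilConv gp (weilReflect gp)) ⊆ Icc (-(2 * (c + b))) (2 * (c + b)) :=
    tsupport_weilConv_weilReflect_subset hgp.2 hgps
  -- additivity of W_E along the parallelogram law
  have hpar : E.functional (weilConv gp (weilReflect gp)) + E.functional (weilConv gm (weilReflect gm)) =
      (E.functional (weilConv u (weilReflect u)) + E.functional (weilConv u (weilReflect u))) +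
        (E.functional (weilConv v (weilReflect v)) + E.functional (weilConv v (weilReflect v))) := by
    rw [← functional_add hE hAp hAm hAps hAms, hparA,
      functional_add hE (hAu.add hAu) (hAv.add hAv) (tsupport_add_subset isClosed_Icc hAus hAus)
        (tsupport_add_subset isClosed_Icc hAvs hAvs),
      functional_add hE hAu hAu hAus hAus, functional_add hE hAv hAv hAvs hAvs]
  -- hence Re Q_E(gm) = 4 Re Q_E(g₁) - Re Q_E(gp) ≤ 4 ε N
  have hQp : 0 ≤ (E.quadratic gp).re := hW gp hgp hgps
  have hQm : (E.quadratic gm).re ≤ 4 * (ε * N) := by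
    have h := congrArg Complex.re hpar
    simp only [Complex.add_re] at h
    have e1 : (E.functional (weilConv u (weilReflect u))).re = (E.quadratic g₁).re := hQu
    have e2 : (E.functional (weilConv v (weilReflect v))).re = (E.quadratic g₁).re := hQv
    have e3 : (E.functional (weilConv gp (weilReflect gp))).re = (E.quadratic gp).re := rfl
    have e4 : (E.functional (weilConv gm (weilReflect gm))).re = (E.quadratic gm).re := rfl
    rw [e1, e2, e3, e4] at h
    linarith
  -- the deletion correction: a finite sum over the visible indices
  have hT : ∀ i, |E.pos i| ≤ 2 * (c + b) → i ∈ (hE.finite_below (2 * (c + b))).toFinset :=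
    fun i h ↦ (hE.finite_below (2 * (c + b))).mem_toFinset.mpr h
  have hdel := E.deleteMasses_functional_eq S hAms hT
  have hw := E.deletedWeightAt_eq_sum S (show 2 * c ≤ 2 * (c + b) by linarith) hT
  -- each deleted visible mass contributes `wt i * (-2N)`
  have hterm : ∀ i ∈ (hE.finite_below (2 * (c + b))).toFinset,
      (if i ∈ S then E.wt i * (weilConv gm (weilReflect gm) (E.pos i) +
          weilConv gm (weilReflect gm) (-E.pos i)) else 0) =
        if i ∈ S ∧ |E.pos i| = 2 * c then E.wt i * (-(2 * (N : ℂ))) else 0 := by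
    intro i _
    by_cases hiS : i ∈ S
    · rcases hpos i hiS with h2c | hfar
      · rw [if_pos hiS, if_pos ⟨hiS, h2c⟩]
        rcases (abs_eq (by linarith : (0 : ℝ) ≤ 2 * c)).mp h2c with h | h
        · rw [h, hA1, hA2]; push_cast; ring
        · rw [h, neg_neg, hA2, hA1]; push_cast; ring
      · have hz1 : weilConv gm (weilReflect gm) (E.pos i) = 0 :=
          apply_eq_zero_of_tsupport_subset hAms hfar
        have hz2 : weilConv gm (weilReflect gm) (-E.pos i) = 0 :=
          apply_eq_zero_of_tsupport_subset hAms (by rwa [abs_neg])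
        have hne : ¬ (i ∈ S ∧ |E.pos i| = 2 * c) := by
          rintro ⟨_, h⟩; rw [h] at hfar; linarith
        rw [if_pos hiS, if_neg hne, hz1, hz2, add_zero, mul_zero]
    · rw [if_neg hiS, if_neg (fun h ↦ hiS h.1)]
  have hsum : (∑ i ∈ (hE.finite_below (2 * (c + b))).toFinset,
      (if i ∈ S then E.wt i * (weilConv gm (weilReflect gm) (E.pos i) +
          weilConv gm (weilReflect gm) (-E.pos i)) else 0)).re =
        -(2 * N) * E.deletedWeightAt S c := by
    rw [Finset.sum_congr rfl hterm, Complex.re_sum, hw, Finset.mul_sum]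
    refine Finset.sum_congr rfl fun i _ ↦ ?_
    split_ifs
    · simp only [Complex.mul_re, Complex.neg_re, Complex.neg_im, Complex.mul_im,
        Complex.ofReal_re, Complex.ofReal_im, Complex.re_ofNat, Complex.im_ofNat]
      ring
    · simp
  -- assemble
  have hfin : ((E.deleteMasses S).quadratic gm).re =
      (E.quadratic gm).re + -(2 * N) * E.deletedWeightAt S c := by
    show ((E.deleteMasses S).functional (weilConv gm (weilReflect gm))).re = _
    rw [hdel, Complex.add_re, hsum]
    rfl
  rw [hfin]
  nlinarith [hQm]

/-- **THEOREM F3-B, dichotomy form** (as `PfPersistenceF5TailTwins.tailDialNegativeOrZetaNotPositive`):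
deleting visible positive mass `w > 2ε` at `± 2c` from a tame host makes the deletion Weil-NEGATIVE at
the explicit twin test of window `c + b` — or the host itself is not Weil-positive up to `c + b`. [folklore] -/
theorem deletion_negative_or_host_not_positive (hE : E.IsTame) {S : Set ℕ} {c b ε : ℝ}
    (hb : 0 < b) (hbc : b < c)
    (hpos : ∀ i ∈ S, |E.pos i| = 2 * c ∨ 2 * (c + b) < |E.pos i|)
    (hwt : ∀ i ∈ S, |E.pos i| = 2 * c → (E.wt i).im = 0 ∧ 0 ≤ (E.wt i).re)
    {g₁ : ℝ → ℂ} (hg : IsWeilTest g₁) (hs : tsupport g₁ ⊆ Icc (-b) b)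
    (hq : (E.quadratic g₁).re ≤ ε * ∫ x, ‖g₁ x‖ ^ 2) (hN : 0 < ∫ x, ‖g₁ x‖ ^ 2)
    (hε : 2 * ε < E.deletedWeightAt S c) :
    ¬ E.PositivityOn (c + b) ∨ ((E.deleteMasses S).quadratic (twin c 1 g₁)).re < 0 := by
  by_cases hW : E.PositivityOn (c + b)
  · exact Or.inr (lt_of_le_of_lt
      (deletionTwinRayleighBound hE S c b ε hb hbc hpos hwt hW g₁ hg hs hq)
      (mul_neg_of_neg_of_pos (by linarith) (by linarith)))
  · exact Or.inl hW

/-- Under the hypotheses of the dichotomy the deletion is NOT Weil-positive up to `c + b` unless the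
host already fails to be (the twin is a Weil test supported in `[-(c+b), c+b]`). [folklore] -/
theorem host_not_positivityOn_or_deletion_not_positivityOn (hE : E.IsTame) {S : Set ℕ} {c b ε : ℝ}
    (hb : 0 < b) (hbc : b < c)
    (hpos : ∀ i ∈ S, |E.pos i| = 2 * c ∨ 2 * (c + b) < |E.pos i|)
    (hwt : ∀ i ∈ S, |E.pos i| = 2 * c → (E.wt i).im = 0 ∧ 0 ≤ (E.wt i).re)
    {g₁ : ℝ → ℂ} (hg : IsWeilTest g₁) (hs : tsupport g₁ ⊆ Icc (-b) b)
    (hq : (E.quadratic g₁).re ≤ ε * ∫ x, ‖g₁ x‖ ^ 2) (hN : 0 < ∫ x, ‖g₁ x‖ ^ 2)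
    (hε : 2 * ε < E.deletedWeightAt S c) :
    ¬ E.PositivityOn (c + b) ∨ ¬ (E.deleteMasses S).PositivityOn (c + b) := by
  refine (deletion_negative_or_host_not_positive hE hb hbc hpos hwt hg hs hq hN hε).imp_right
    fun hneg hP ↦ ?_
  have hc0 : 0 ≤ c := by linarith
  have h0 := hP (twin c 1 g₁)
    (Summit.RiemannHypothesis.RiemannHypothesis.Theorems.PfPersistenceF5TailTwins.isWeilTest_twin hg c 1)
    (Summit.RiemannHypothesis.RiemannHypothesis.Theorems.PfPersistenceF5TailTwins.tsupport_twin_subset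
      hs hc0 1)
  linarith

/-! ## The instance `E = ζ`, one prime deleted: F5-A at `K = 0` recovered from F3-B -/

/-- The weight `ζ` loses at `± log p` when the prime `p` is deleted: `Λ(p)/√p = log p/√p`. [folklore] -/
theorem zetaDatum_deletedWeightAt_prime {p : ℕ} (hp : p.Prime) :
    zetaDatum.deletedWeightAt {p} (Real.log p / 2) = Real.log p / Real.sqrt p := by
  unfold deletedWeightAt
  have hlog : 0 ≤ Real.log (p : ℝ) := Real.log_nonneg (by exact_mod_cast hp.one_lt.le)
  rw [tsum_eq_single p]
  · have hc : p ∈ ({p} : Set ℕ) ∧ |zetaDatum.pos p| = 2 * (Real.log p / 2) := by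
      refine ⟨Set.mem_singleton p, ?_⟩
      show |Real.log (p : ℝ)| = 2 * (Real.log p / 2)
      rw [abs_of_nonneg hlog]; ring
    rw [if_pos hc]
    show ((((ArithmeticFunction.vonMangoldt p : ℝ)) : ℂ) / (Real.sqrt p : ℂ)).re = _
    rw [← Complex.ofReal_div, Complex.ofReal_re, ArithmeticFunction.vonMangoldt_apply_prime hp]
  · intro i hi
    rw [if_neg]
    rintro ⟨h, _⟩
    exact hi (Set.mem_singleton_iff.mp h)

/-- **F5-A at `K = 0` as the instance `E = zetaDatum`, `S = {p}` of THEOREM F3-B** (consistency check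
with `PfPersistenceF5TailTwins.tailDialRayleighBound`: the same constant `2ε - log p/√p`): deleting the
prime `p` from `ζ`, assumed Weil-positive up to `(log p)/2 + b`, gives a form `≤ (2ε - log p/√p)·2‖g₁‖₂²`
at the twin of any `g₁` supported in `[-b, b]` with Rayleigh quotient `≤ ε`. [folklore] -/
theorem zeta_primeDeletion_rayleighBound {p : ℕ} (hp : p.Prime) {b ε : ℝ} (hb : 0 < b)
    (hb2 : b < Real.log p / 2) (hW : WeilPositivityOn (Real.log p / 2 + b))
    {g₁ : ℝ → ℂ} (hg : IsWeilTest g₁) (hs : tsupport g₁ ⊆ Icc (-b) b)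
    (hq : (weilQuadratic g₁).re ≤ ε * ∫ x, ‖g₁ x‖ ^ 2) :
    ((zetaDatum.deleteMasses {p}).quadratic (twin (Real.log p / 2) 1 g₁)).re ≤
      (2 * ε - Real.log p / Real.sqrt p) * (2 * ∫ x, ‖g₁ x‖ ^ 2) := by
  have hlog : 0 ≤ Real.log (p : ℝ) := Real.log_nonneg (by exact_mod_cast hp.one_lt.le)
  have hpos : ∀ i ∈ ({p} : Set ℕ), |zetaDatum.pos i| = 2 * (Real.log p / 2) ∨
      2 * (Real.log p / 2 + b) < |zetaDatum.pos i| := by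
    intro i hi
    rw [Set.mem_singleton_iff.mp hi]
    left
    show |Real.log (p : ℝ)| = 2 * (Real.log p / 2)
    rw [abs_of_nonneg hlog]; ring
  have hwt : ∀ i ∈ ({p} : Set ℕ), |zetaDatum.pos i| = 2 * (Real.log p / 2) →
      (zetaDatum.wt i).im = 0 ∧ 0 ≤ (zetaDatum.wt i).re := by
    intro i hi _
    rw [Set.mem_singleton_iff.mp hi]
    show ((((ArithmeticFunction.vonMangoldt p : ℝ)) : ℂ) / (Real.sqrt p : ℂ)).im = 0 ∧
      0 ≤ ((((ArithmeticFunction.vonMangoldt p : ℝ)) : ℂ) / (Real.sqrt p : ℂ)).re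
    rw [← Complex.ofReal_div, Complex.ofReal_im, Complex.ofReal_re]
    exact ⟨rfl, div_nonneg ArithmeticFunction.vonMangoldt_nonneg (Real.sqrt_nonneg _)⟩
  have h := deletionTwinRayleighBound zetaDatum_isTame {p} (Real.log p / 2) b ε hb hb2 hpos hwt
    ((zetaDatum_positivityOn_iff _).mpr hW) g₁ hg hs (by rwa [zetaDatum_quadratic])
  rwa [zetaDatum_deletedWeightAt_prime hp] at h

end ExplicitDatum

end Summit.RiemannHypothesis.RiemannHypothesis.Theorems.PfPersistenceBarrier

end
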